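import Summits.BirchSwinnertonDyer.Rank1Residual.X2.SelmerDivisibleOfNoFiniteSubmodule
import Summits.BirchSwinnertonDyer.Rank1Residual.X2.NonPrimitiveLambdaInvariantOfDatum
import Summits.BirchSwinnertonDyer.Rank1Residual.X2.GreenbergVatsalThm13DatumFree
import Literature.NumberTheory.EllipticCurves.GreenbergVatsal2000.NonPrimitiveSelmerDivisible
import HarnessLib

/-!
# GV Prop. (2.5)/p. 25 at a good ORDINARY prime DERIVED: the record A116
# `GreenbergVatsal2000.divisible_nonPrimitiveSelmerInfty_of_mu_eq_zero` (divisibility of the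
# classical non-primitive Selmer group `Sel^{Σ₀}_E(ℚ_∞)_p` at `μ = 0`) is a COROLLARY of
# Greenberg's Prop. 4.15 (ii), GV Cor. (2.3)'s divisible quotient (T-GV23L) and `L_𝔭 ⊆ im κ_𝔭`
# (A111); and the A14 = GV Thm. (1.3) derivation re-threaded through it

HONEST FRAMING (BSD rank-`≤ 1` residual cell `b2b-bsdres`, home
`run/shared/lean/b2b/bsd-rank1-residual/`, unit `b2b-bsdres-eisenstein-p2`, class X2; research route,
no claim beyond stated classes; nothing booked here; labels unchanged): the cell deletes the
COMBINATION-SHAPED residual classes of the rank-`≤ 1` BSD formula from PUBLISHED theorems only and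
TYPES the construction-shaped ones; this is not "finishing BSD". THEOREMS ONLY (no definition, no
named fact, nothing asserted).

## What (gen 31, programme P2 step 3; registry: A116 DERIVED ⇐ {Prop. 4.15 (ii), T-GV23L, A111})

A116 (GV p. 25 for the classical groups at a good ordinary prime, p. 26's identification
`Sel_E(ℚ_∞)_p = S_A(ℚ_∞)`, `Sel^{Σ₀}_E(ℚ_∞)_p = S^{Σ₀}_A(ℚ_∞)`): for `E/ℚ` globally minimal, `p` odd
good ordinary, `κ` cyclotomic with topological generator `γ`, `Σ₀ ∌ p` finite, a finitely generated
torsion dual datum `D` with `μ = 0`: `Sel^{Σ₀}_E(ℚ_∞)_p = p · Sel^{Σ₀}_E(ℚ_∞)_p`. THIS FILE proves it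
(as the registered `Prop`, verbatim) from three records:
* `Sel_E(ℚ_∞)_p` is divisible — Greenberg's Prop. 4.15 (ii) at a good ordinary `p ≥ 3` + `μ = 0` +
  Pontryagin (`SelmerDivisibleOfNoFiniteSubmodule.selmerInfty_divisible_of_prop415ii`, `h415`);
* `Sel^{Σ₀}/Sel = S^{Σ₀}_A/S_A` is divisible — the fifth conjunct of T-GV23L (`h23`) at Greenberg's
  reduction datum `C = ker(E[p^∞] → Ẽ)` (a divisible line with `#C[p] = p`, `E(ℚ_∞)[p^∞]` finite:
  gen 26's `NonPrimitiveLambdaInvariantOfDatum`), after p. 26's identification of the classical and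
  datum groups (A111 `hGV`: `L_𝔭 ⊆ im κ_𝔭`; tree `Additive.selmerInfty_eq_datumSelmerInfty`,
  `Additive.nonPrimitiveSelmerInfty_eq_datumSelmerInfty`) and transport of `D` to a datum dual
  (`exists_datumDualData_of_selmerDualData`);
* "divisible-by-divisible is divisible".
A116's hypothesis "good reduction outside `Σ₀ ∪ {p}`" is not used.

Consequence for the A14 chain (GV Thm. (1.3), printed good-ordinary setting):
**`thm13_charIdeal_eq_of_gvPar_of_prop415ii`** — `thm13_charIdeal_eq_of_gvPar` from TEN records
{A111 `hGV`, A40, A41, Prop. 4.15 (ii), T-GV23L, A195, W16, A226, A224, A225} (gen 30's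
`thm13_charIdeal_eq_of_gvPar_datumFree` with its `hB` = A116 fed by this file). The term with A116
as a binder (nine records) remains the shorter one; this is the alternative in which the only GV §2
input is Cor. (2.3).

References: R. Greenberg, V. Vatsal, Invent. Math. 142 (2000) = arXiv:math/9906215, §2 Cor. (2.3)
pp. 20–21, Prop. (2.5) p. 23, p. 25, p. 26; R. Greenberg, LNM 1716 (1999), Prop. 4.15 (ii), §2
Props. 2.2, 2.4 (pp. 73–75).
-/

noncomputable section

open scoped Classical AddSubgroup

namespace Summit.BirchSwinnertonDyer.Rank1Residual.X2.NonPrimitiveSelmerDivisibleGoodOrdinaryDerived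

open NumberField IsDedekindDomain Field WeierstrassCurve
  Literature.NumberTheory.EllipticCurves Literature.NumberTheory.EllipticCurves.GreenbergSelmer
  Literature.NumberTheory.EllipticCurves.GreenbergVatsal2000
  Literature.NumberTheory.GaloisRepresentations
  Summit.BirchSwinnertonDyer.Rank1Residual.X2.GreenbergVatsalReductionDatum
  Summit.BirchSwinnertonDyer.Rank1Residual.X2.GreenbergVatsalStrictAtP
  Summit.BirchSwinnertonDyer.Rank1Residual.X2.GreenbergSelmerCountSplit
  Summit.BirchSwinnertonDyer.Rank1Residual.X2.NonPrimitiveLambdaInvariantOfDatum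
  Summit.BirchSwinnertonDyer.Rank1Residual.X2.SelmerDivisibleOfNoFiniteSubmodule

/-- **A116 DERIVED (GV p. 25 at a good ordinary prime ⇐ Prop. 4.15 (ii) + T-GV23L + A111).** The
registered `Prop` `divisible_nonPrimitiveSelmerInfty_of_mu_eq_zero` — "IF `S^{Σ₀}_A(ℚ_∞)` is
`Λ`-cotorsion with `μ = 0` THEN `S^{Σ₀}_A(ℚ_∞) ≅ (ℚ_p/ℤ_p)^λ` is `p`-divisible", classical groups at
good ordinary `p` — from Greenberg's Prop. 4.15 (ii) (`h415`: `X(E/ℚ_∞)` has no nonzero finite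
`Λ`-submodule, hence `Sel_E(ℚ_∞)_p` is divisible at `μ = 0`), GV Cor. (2.3) (`h23`: `S^{Σ₀}_A/S_A`
divisible) and `L_𝔭 ⊆ im κ_𝔭` (`hGV`, GV p. 26's `Sel = S_A`).
[cite: GreenbergVatsal2000, §2 Prop. (2.5) p. 23, p. 25; Cor. (2.3) pp. 20–21; p. 26]
[cite: GreenbergLNM1716, Prop. 4.15 (ii); §2 Props. 2.2, 2.4 (pp. 73–75)] -/
theorem divisible_nonPrimitiveSelmerInfty_of_mu_eq_zero_of_prop415ii
    (h415 : Greenberg1999.prop415ii_noFiniteSubmodule_of_ordinary_or_multiplicative)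
    (h23 : datumSelmer_nonPrimitive_invariants) (hGV : imKummer_ge_greenbergCondition_at_p) :
    divisible_nonPrimitiveSelmerInfty_of_mu_eq_zero := by
  intro W _ _ p _ hp2 hgood hord κ hκ γ hγ S₀ hS₀ _ D _ hX hμ
  have hp3 : 3 ≤ p := by have := (Fact.out : p.Prime).two_le; omega
  have hΔ : ¬ (p : ℤ) ∣ minimalDiscriminantInt W :=
    W.not_dvd_minimalDiscriminantInt_of_hasGoodReductionAtPrime' p hgood
  set S₀' : Set (HeightOneSpectrum (𝓞 ℚ)) := ↑S₀ with hS₀'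
  -- Greenberg's reduction data above `p` and its three properties (gen 26)
  have hRD : ∀ (v : HeightOneSpectrum (𝓞 ℚ)) (hv : ((p : ℕ) : 𝓞 ℚ) ∈ v.asIdeal),
      (reductionData W p hΔ v hv).greenbergKer κ.kerSubgroup =
        W.localKerOver p κ.kerSubgroup (v.adicCompletion ℚ) :=
    fun v hv ↦ (localKerOver_eq_greenbergKer_and_strictKer W p κ hGV hκ hv hΔ hord).1.symm
  have hC : ∀ (v : HeightOneSpectrum (𝓞 ℚ)) (hv : ((p : ℕ) : 𝓞 ℚ) ∈ v.asIdeal),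
      (∀ c ∈ (reductionData W p hΔ v hv).plus, ∃ c' ∈ (reductionData W p hΔ v hv).plus, p • c' = c) ∧
        Nat.card ↥((reductionData W p hΔ v hv).plus ⊓ (↥(W.geomPrimaryTorsion p))[(p : ℤ)]) = p :=
    fun v hv ↦ ⟨Additive.reductionDatum_divisible W p hv hΔ hord,
      natCard_reductionData_plus_inf_torsionBy W p hΔ hord v hv⟩
  have hA : Finite (FixedPoints.addSubgroup κ.kerSubgroup (W.geomPrimaryTorsion p)) :=
    W.finite_fixedPoints_kerSubgroup_geomPrimaryTorsion_of_ordinary κ hp2 hgood hord hκ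
  -- classical = datum, primitive and non-primitive
  have hSel : W.selmerInfty κ =
      datumSelmerInfty κ (W.geomPrimaryTorsion p) (reductionData W p hΔ) ∅ :=
    Additive.selmerInfty_eq_datumSelmerInfty W p κ hp2 hκ (reductionData W p hΔ) hRD
  have hNP : nonPrimitiveSelmerInfty W κ S₀' =
      datumSelmerInfty κ (W.geomPrimaryTorsion p) (reductionData W p hΔ) S₀' :=
    Additive.nonPrimitiveSelmerInfty_eq_datumSelmerInfty W p κ _ hp2 hκ (reductionData W p hΔ) hRD
      (fun v hv ↦ hS₀ v (Finset.mem_coe.1 hv))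
  -- `Sel` is divisible (Prop. 4.15 (ii))
  have hSelDiv : ∀ s ∈ datumSelmerInfty κ (W.geomPrimaryTorsion p) (reductionData W p hΔ) ∅,
      ∃ t ∈ datumSelmerInfty κ (W.geomPrimaryTorsion p) (reductionData W p hΔ) ∅, p • t = s := by
    rw [← hSel]
    exact selmerInfty_divisible_of_prop415ii W p h415 hp3 (Or.inl ⟨hgood, hord⟩) hκ hγ D hX hμ
  -- `S^{Σ₀}_A/S_A` is divisible (Cor. (2.3), T-GV23L at the transported dual of `Sel` and the
  -- canonical dual of `S^{Σ₀}_A`)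
  obtain ⟨X, ⟨eX⟩⟩ := exists_datumDualData_of_selmerDualData W D hSel
  haveI : Module.Finite (IwasawaAlgebra p) X.X := Module.Finite.equiv eX.symm
  have hXt : Module.IsTorsion (IwasawaAlgebra p) X.X :=
    isTorsion_of_injective eX.toLinearMap eX.injective hX
  obtain ⟨-, -, -, -, hQ⟩ := h23 W p hp2 κ hκ γ hγ (reductionData W p hΔ) hC hA S₀ hS₀ X
    (datumDualData W κ (reductionData W p hΔ) S₀' hγ) hXt
  have hmono : datumSelmerInfty κ (W.geomPrimaryTorsion p) (reductionData W p hΔ) ∅ ≤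
      datumSelmerInfty κ (W.geomPrimaryTorsion p) (reductionData W p hΔ) S₀' :=
    gvSelmerInfty_empty_le W p κ (reductionData W p hΔ) S₀'
  -- assemble
  rw [hNP]
  exact divisible_of_divisible_quotient p hmono hSelDiv hQ

/-- **A14 (GV Thm. (1.3) with Kato's Thm. (1.2) ⇒ Mazur's main conjecture under (GV), printed good
ordinary setting) from TEN records, A116 fed by Prop. 4.15 (ii) + T-GV23L + A111**: gen 30's
`GreenbergVatsalThm13DatumFree.thm13_charIdeal_eq_of_gvPar_datumFree` with its binder `hB` (A116)
replaced by `divisible_nonPrimitiveSelmerInfty_of_mu_eq_zero_of_prop415ii`. Binders: `hGV` (A111),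
`hT`/`hT'` (A40/A41), `h415` (Greenberg Prop. 4.15 (ii)), `h23` (T-GV23L), `hLiftF` (A195), `hW16`
(Wuthrich Thm. 16 / Kato), `h311` (A226), `hC`/`hD` (A224/A225). Bookkeeping.
[cite: GreenbergVatsal2000, Thm. (1.3), §2 pp. 25–26, §3 Thm. (3.11)]
[cite: GreenbergLNM1716, Prop. 4.15 (ii)] -/
theorem thm13_charIdeal_eq_of_gvPar_of_prop415ii
    (hGV : imKummer_ge_greenbergCondition_at_p)
    (hT : Silverman1994_thmV53_tateUniformisation.{0})
    (hT' : Silverman1994_thmV53_corV54_tateUniformisation.{0})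
    (h415 : Greenberg1999.prop415ii_noFiniteSubmodule_of_ordinary_or_multiplicative)
    (h23 : datumSelmer_nonPrimitive_invariants)
    (hLiftF : residualEpsilon_surjOn_of_lineRamifiedEven)
    (hW16 : Wuthrich2014.charIdeal_dvd_padicLFunction)
    (h311 : thm311_hasUnitContent_iff_and_order_eq_of_lineRamifiedEven)
    (hC : characterLFunctionC_hasUnitContent_and_order_eq_card)
    (hD : characterLFunctionD_hasUnitContent_and_order_eq_card) :
    thm13_charIdeal_eq_of_gvPar :=
  GreenbergVatsalThm13DatumFree.thm13_charIdeal_eq_of_gvPar_datumFree hGV hT hT'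
    (divisible_nonPrimitiveSelmerInfty_of_mu_eq_zero_of_prop415ii h415 h23 hGV) hLiftF hW16 h311 hC hD

/-! ## Appended (gen 31): A14 from EIGHT records, no GV §2 curve-level record, no Tate / period fact -/

/-- **A14 (GV Thm. (1.3) + Kato's Thm. (1.2) ⇒ Mazur's main conjecture under (GV), printed good
ordinary setting) from EIGHT records {A111 `hGV`, T-GV23L `h23`, Greenberg Prop. 4.15 (ii) `h415`,
A195 `hLiftF`, W16 `hW16`, A226 `h311`, A224 `hC`, A225 `hD`}** — gen 28's Tate-free and period-free
term `GreenbergVatsalThm13PeriodFree.thm13_charIdeal_eq_of_gvPar_periodFree_of_datum` (binders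
`hGV`, `h23`, `hB` = A116, `hLiftF`, `hW16`, `h311`, `hC`, `hD`) with A116 fed by
`divisible_nonPrimitiveSelmerInfty_of_mu_eq_zero_of_prop415ii h415 h23 hGV`. Same count (eight) as the
shortest A14 term, with the GV §2 curve-level records A115/A116 BOTH replaced by the datum record
T-GV23L (already a binder) and Greenberg's Prop. 4.15 (ii); no Tate uniformisation (A40/A41), no
period clause. Bookkeeping. [cite: GreenbergVatsal2000, Thm. (1.3), §2 Cor. (2.3), pp. 25–26, §3 Thm. (3.11)]
[cite: GreenbergLNM1716, Prop. 4.15 (ii)] -/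
theorem thm13_charIdeal_eq_of_gvPar_of_datum_of_prop415ii
    (hGV : imKummer_ge_greenbergCondition_at_p) (h23 : datumSelmer_nonPrimitive_invariants)
    (h415 : Greenberg1999.prop415ii_noFiniteSubmodule_of_ordinary_or_multiplicative)
    (hLiftF : residualEpsilon_surjOn_of_lineRamifiedEven)
    (hW16 : Wuthrich2014.charIdeal_dvd_padicLFunction)
    (h311 : thm311_hasUnitContent_iff_and_order_eq_of_lineRamifiedEven)
    (hC : characterLFunctionC_hasUnitContent_and_order_eq_card)
    (hD : characterLFunctionD_hasUnitContent_and_order_eq_card) :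
    thm13_charIdeal_eq_of_gvPar :=
  GreenbergVatsalThm13PeriodFree.thm13_charIdeal_eq_of_gvPar_periodFree_of_datum hGV h23
    (divisible_nonPrimitiveSelmerInfty_of_mu_eq_zero_of_prop415ii h415 h23 hGV) hLiftF hW16 h311 hC hD

end Summit.BirchSwinnertonDyer.Rank1Residual.X2.NonPrimitiveSelmerDivisibleGoodOrdinaryDerived

end
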